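import Summits.BirchSwinnertonDyer.BirchSwinnertonDyer.Theorems.QuadraticBranchSignedControlPlusEtaNonsurjConjADoorUnitBSD
import Summits.BirchSwinnertonDyer.Rank1Residual.X11b.ChaPairsMinimality
import Summits.BirchSwinnertonDyer.Rank1Residual.X11b.KrausMinimalityGeneralTwo
import HarnessLib

/-!
# Route `QuadraticBranchSignedControl` (rung K8, cell `bsd-potss`), residual crux `PlusEtaMainConjectureNonsurj`
# (stmt-BirchSwinnertonDyer-19606): RECORDS C — u5a:29, the UNCONGRUENT rank-zero unit partner with a TWO-dimensional tautological eigenspace: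
# (C1⁺_η)@5 AND `MissingPPartAt W 5` BY NAME through door L4 read on the whole eigenspace (seat `bsd-potss-k8eta-c2` g22; kit j330695, NEW engine e5h2)

WHAT. `W = [1,−1,1,−84303680,297791997822]` (`N_W = 917930475`), the `5`-partner of `A^{(29)}`, `A = [1,−1,1,−4010,98676]` (Zywina's `X_ns⁺(5)` point
`t = 4/5`; UNCONGRUENT class): `h(ℚ(P)) = 1500 = [30,10,5]`, eigen dimensions `(d₁,d₂,d₃,d₄) = (0,2,0,1)` — the only resolved u5a member with `d₂ = 2`
(g21 j326613). conjA g13's one-vector Hecke engine returned INCONSISTENT (this seat, j330275: `T_y h ∉ 𝔽₅h`); the engine e5h2 (this seat) computes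
`T_y` on the WHOLE eigenspace `E₂` (it is `T_y`-stable: `σ₂ = y⁶` is central): matrix `[3,2;1,4]` over `𝔽₅`, characteristic polynomial `z(z+3)`,
eigenvalues `{0, 2} = {0, −Tr}` with `Tr ρ̄(y) = 3` — a `V₉`-companion line and a twist-companion line, `ρ̄` does NOT occur, so the Hecke-refined
eigen-test of door L4 passes (the displayed hypothesis of `EtaConjADoorUnit.…_of_heckeEigenHom_of_isUnit` asks exactly that no tautological
functional with `T_y`-eigenvalue `Tr` exists). Control in the same job: the in-table CM rank-2 row 195075s1 (`d₂ = 2 = s_W + s_V`): matrix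
`[1,1;0,4]`, eigenvalues `{1, 4} = {−Tr, Tr}` — RHO OCCURS, as pre-registered (P-22D 2/2). `s_W(W_29) = 0`, `s_V = 1` (`V_29` has rank 2; j330635).
The row is a UNIT row (`ε = +1`, PARI plus-`η` `(λ, μ) = (0, 0)`, `r_an = 0`): §1 `etaMC_unit_u5a_29_5_of_heckeEigenHom` ((C1⁺_η), p715862's door),
§2 `missingPPartAt_u5a_29_5_of_heckeEigenHom` (`ord₅ #Ш = ord₅ #Ш_an`, p717939's composition; kernel global minimality on the support
`|Δ| = 3⁴·5⁶·7³·11⁵·29⁶`). With records A/B and BSD records I/II: TWELVE uncongruent rows at (C1⁺_η) level, SIX of them at `BSD_5` level unconditionally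
on C-cc-1 (all rank 0).

HONEST FRAMING (cell `bsd-potss`; FULL-BSD rank ≤ 1 programme, HUMAN RULING D-0036/D-0074): per-row RECORDS, CONDITIONAL on the displayed named
facts and per-row inputs (tower clause, unit certificate, the Hecke-refined eigen datum, `r_an = 0`, the twin `V`); GRH numerics are evidence, not
facts; `BSD(W,5)` ASSERTED for no pair; no stub of 19606 proved; crux and route OPEN; nothing booked. `--supports stmt-BirchSwinnertonDyer-19606`.

References: [Kobayashi2003] Thm. 1.2, 2.2, §4, Thm. 4.1, 9.3; [KitajimaOtsuki2018] Main Thm. 1.3; [DeoRaySujatha2023] Thm. 3.8; [Miller2011LMS] Def. 1.1;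
[CoatesSujatha2005] §3 (A); [SilvermanAEC2009] VII.1 Rem. 1.1; [Zywina2015] Thm. 1.4.
-/

set_option autoImplicit false
set_option linter.dupNamespace false
noncomputable section

open scoped Classical nonZeroDivisors

open CongruenceSubgroup NumberField Field WeierstrassCurve
open Literature.NumberTheory.EllipticCurves Literature.NumberTheory.EllipticCurves.ModularForms
  Literature.NumberTheory.EllipticCurves.Rank1Residual Literature.NumberTheory.EllipticCurves.Rank1Residual.Typed
  Literature.NumberTheory.GaloisRepresentations Literature.NumberTheory.GaloisCohomology Literature.NumberTheory.NumberFields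
  Literature.NumberTheory.EllipticCurves.GreenbergVatsal2000 ZpExtension
open Summit.BirchSwinnertonDyer.Rank1Residual Summit.BirchSwinnertonDyer.Rank1Residual.Additive
open Summit.BirchSwinnertonDyer.Rank1Residual.X11b (isElliptic_of_discOf_ne_zero)
open Summit.BirchSwinnertonDyer.BirchSwinnertonDyer.Theorems
open Summit.BirchSwinnertonDyer.Rank1Residual.X11b (isElliptic_of_discOf_ne_zero isGloballyMinimal_of_krausCriterion_support)
open Summit.BirchSwinnertonDyer.BirchSwinnertonDyer.Theorems.EtaConjADoorUnit (quadraticBranchPlusEtaMainConjectureAt_of_heckeEigenHom_of_isUnit)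

namespace Summit.BirchSwinnertonDyer.BirchSwinnertonDyer.Theorems.EtaConjADoorUnitBSDRecords

/-- The `5`-partner of u5a:29, `W = [1, -1, 1, -84303680, 297791997822]` (non-CM, `N_W = 917930475`; `j(W) = j(A)` for the quadratic twist
`A^{(29)}` of `A = [1,−1,1,−4010,98676]` (the `t = 4/5` point of Zywina's `X_ns⁺(5)` family; non-CM, mod-`5` image `C_ns⁺(5)`, NOT `5`-congruent to
any CM row — k8eta-c2 g19 p666083: the domain of v7's hardest stub `stub_etaMC_nonCM_uncongruent`)): `Δ ≠ 0` (kernel). [cite: Zywina2015, Thm. 1.4]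
-/
theorem isElliptic_u5a_29 : (⟨1, (-1), 1, (-84303680), 297791997822⟩ : WeierstrassCurve ℚ).IsElliptic :=
  isElliptic_of_discOf_ne_zero 1 (-1) 1 (-84303680) 297791997822 (by decide +kernel)

/-- **(C1⁺_η) at `p = 5` for every good `a_5 = 0` model `V` of the `5`-twist of the UNCONGRUENT UNIT partner u5a:29** (`W = [1, -1, 1, -84303680,
297791997822]`, non-CM, `N_W = 917930475`; kit j326613/j330695 (1171+2466 s, GRH): `ε(W) = +1`, PARI plus-`η` `(λ, μ) = (0, 0)` — `L_5⁺(V,η,T)` is a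
UNIT of `Λ` —, `r_an(W) = 0` (`ellanalyticrank`); `h(ℚ(P)) = 1500` (`[30,10,5]`), `h(ℚ(x(P))) = 15`; eigen dimensions `(d₁,d₂,d₃,d₄) = (0,2,0,1)`;
Hecke datum (conjA g13 hecke13 engine, kit j330695 (engine e5h2: T_y on the whole 2-dimensional eigenspace E₂)): `Tr ρ̄(y) = 3`, `T_y` acts on the
tautological line by `c = {0, 2} = {0, −Tr} (matrix [3,2;1,4] on E₂, char. poly. z(z+3))` — verdict PASS-L4 (Tr = 3 is NOT an eigenvalue of T_y on
E₂: the plane is a `V₉`-companion ⊕ a twist companion, ρ̄ does not occur; (c2) for `W` holds; the one-vector engine had returned INCONSISTENT, kit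
j330275) — door L4 (Hecke-refined eigen-test) passes) from the ROW ALONE — named facts `h22 h41 h6273` ONLY (no `hGZK`, no `r_an`, no `L₀`);
displayed: the tower clause, the unit certificate «every `L_5⁺(V,η,T)` is a unit», the class-group datum. Instance of
`EtaConjADoorUnit.quadraticBranchPlusEtaMainConjectureAt_of_heckeEigenHom_of_isUnit` (k8eta-c2 g22, p715862). CONDITIONAL; nothing booked. [cite:
Kobayashi2003, §4 (p. 8), Thm. 2.2 (p. 5)] [cite: CoatesSujatha2005, §3 (A) and Thm. 3.4] [cite: Zywina2015, Thm. 1.4] -/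
theorem etaMC_unit_u5a_29_5_of_heckeEigenHom
    (h22 : Kobayashi2003.thm22_etaSignedSelmerDual_finite_torsion)
    (h41 : Kobayashi2003.thm41_plusEtaCharIdeal_dvd)
    (h6273 : Kobayashi2003.thm62_63_73_etaColemanPoitouTate) [Fact (5 : ℕ).Prime]
    (W : WeierstrassCurve ℚ) (hW : W = (⟨1, (-1), 1, (-84303680), 297791997822⟩ : WeierstrassCurve ℚ))
    (V : WeierstrassCurve ℚ) [V.IsElliptic] [V.IsGloballyMinimal] (C : VariableChange ℚ)
    (hC : C • W.quadraticTwist 5 = V)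
    (hgood : V.HasGoodReductionAtPrime 5) (hap : V.frobeniusTrace 5 = 0)
    (hns : ¬ ∀ m : ℕ, V.HasSurjectiveModNGaloisRep (5 ^ m : ℕ))
    (hunit : ∀ {N : ℕ} [NeZero N] {f : CuspForm (Gamma0 N) 2}, IsNewformOf V f →
      ∀ (ϖ : ℚ), (if Even (5 / 2) then (ϖ : ℝ) * V.realPeriodRat = plusPeriod f
          else (ϖ : ℝ) * V.imaginaryPeriodRat = minusPeriod f) →
      ∀ (Lη : IwasawaAlgebra 5), IsQuadraticBranchPlusLFunction f 5 ϖ Lη → IsUnit Lη)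
    (hP : haveI : W.IsElliptic := hW ▸ isElliptic_u5a_29
      haveI : NeZero (5 : ℕ) := ⟨by norm_num⟩
      haveI : NumberField (W.divisionField 5) := NumberField.mk
      ∃ P : geomTorsion W ((5 : ℕ) : ℤ), P ≠ 0 ∧
        ∀ K : IntermediateField ℚ (W.divisionField 5),
          K = IntermediateField.fixedField
            ((MulAction.stabilizer (absoluteGaloisGroup ℚ) P).map (absRestrictNormalHom (W.divisionField 5))) →
        ∀ μ : Additive (ClassGroup (𝓞 K)) →+ ZMod 5,
          (∀ (τ : absoluteGaloisGroup ℚ) (σ : K ≃ₐ[ℚ] K) (a : ℕ),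
              (∀ x : K, absRestrictNormalHom (W.divisionField 5) τ (x : W.divisionField 5) =
                ((σ x : K) : W.divisionField 5)) → τ • P = a • P →
              ∀ (I J : (Ideal (𝓞 K))⁰),
                (J : Ideal (𝓞 K)) = (I : Ideal (𝓞 K)).map (AmbiguousClass.intAut σ : 𝓞 K →+* 𝓞 K) →
                μ (Additive.ofMul (ClassGroup.mk0 J)) = a • μ (Additive.ofMul (ClassGroup.mk0 I))) →
          (∀ (τ τ₁ : absoluteGaloisGroup ℚ) (a a₁ b : ℕ) (Q : geomTorsion W ((5 : ℕ) : ℤ)),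
              τ • P = a • P + Q → τ₁ • P = a₁ • P → τ₁ • Q = b • Q → (a₁ : ZMod 5) ≠ (b : ZMod 5) →
              ∀ I : (Ideal (𝓞 K))⁰,
                μ (Additive.ofMul (classGroupNorm K (W.divisionField 5) (ClassGroup.mulEquiv
                  (AmbiguousClass.intAut (absRestrictNormalHom (W.divisionField 5) τ))
                    (classGroupExtend K (W.divisionField 5) (ClassGroup.mk0 I))))) =
                  (Nat.card ((W.divisionField 5) ≃ₐ[K] (W.divisionField 5)) * a) •
                    μ (Additive.ofMul (ClassGroup.mk0 I))) →
          μ = 0) :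
    QuadraticBranchPlusEtaMainConjectureAt V 5 := by
  subst hW
  haveI : (⟨1, (-1), 1, (-84303680), 297791997822⟩ : WeierstrassCurve ℚ).IsElliptic := isElliptic_u5a_29
  haveI : NeZero (5 : ℕ) := ⟨by norm_num⟩
  exact quadraticBranchPlusEtaMainConjectureAt_of_heckeEigenHom_of_isUnit 5 V _ C h22 h41 h6273 (le_refl 5)
    (by rw [show ((-1 : ℚ) ^ ((5 : ℕ) / 2) * ((5 : ℕ) : ℚ)) = 5 by norm_num]; exact hC) hgood hap hns hP hunit

set_option maxRecDepth 100000 in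
/-- `W = [1, -1, 1, -84303680, 297791997822]` is a global minimal equation (Silverman VII.1 Rem. 1.1 on the support `|Δ| = 3^4 · 5^6 · 7^3 · 11^5 ·
29^6` — at every prime `q` of the support `q¹² ∤ Δ` or `q⁴ ∤ c₄`, or Kraus's test at `2`; tree `isGloballyMinimal_of_krausCriterion_support`, kernel
`decide`). [cite: SilvermanAEC2009, VII.1 Remark 1.1] [cite: Kraus1989, Prop. 1 and Prop. 2] -/
theorem isGloballyMinimal_u5a_29 : (⟨1, (-1), 1, (-84303680), 297791997822⟩ : WeierstrassCurve ℚ).IsGloballyMinimal :=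
  isGloballyMinimal_of_krausCriterion_support 1 (-1) 1 (-84303680) 297791997822 [(3, 0, 4), (5, 0, 6), (7, 0, 3), (11, 0, 5), (29, 0, 6)]
    (by
      intro t ht
      simp only [List.mem_cons, List.not_mem_nil, or_false] at ht
      rcases ht with rfl | rfl | rfl | rfl | rfl <;> norm_num)
    (by decide +kernel) (by decide +kernel)

/-- **`MissingPPartAt W 5` — `ord_5 #Ш(W) = ord_5 #Ш_an(W)`, the `5`-part of `BSD(W,5)` — for the UNCONGRUENT UNIT partner u5a:29, granted ONE good
`a_5 = 0` globally minimal model `V` of `W^{(5)}` with non-onto `5`-adic tower** (`W = [1, -1, 1, -84303680, 297791997822]`, non-CM, `N_W =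
917930475`; kit j326613/j330695 (1171+2466 s, GRH): `ε(W) = +1`, PARI plus-`η` `(λ, μ) = (0, 0)` — `L_5⁺(V,η,T)` is a UNIT of `Λ` —, `r_an(W) = 0`
(`ellanalyticrank`); `h(ℚ(P)) = 1500` (`[30,10,5]`), `h(ℚ(x(P))) = 15`; eigen dimensions `(d₁,d₂,d₃,d₄) = (0,2,0,1)`; Hecke datum (conjA g13 hecke13
engine, kit j330695 (engine e5h2: T_y on the whole 2-dimensional eigenspace E₂)): `Tr ρ̄(y) = 3`, `T_y` acts on the tautological line by `c = {0, 2}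
= {0, −Tr} (matrix [3,2;1,4] on E₂, char. poly. z(z+3))` — verdict PASS-L4 (Tr = 3 is NOT an eigenvalue of T_y on E₂: the plane is a `V₉`-companion
⊕ a twist companion, ρ̄ does not occur; (c2) for `W` holds; the one-vector engine had returned INCONSISTENT, kit j330275) — door L4 (Hecke-refined
eigen-test) passes) from the ROW ALONE — named facts `hGZK hmod hnf hM h12 hKO h22 h41 h6273` (GZK, modularity, newforms, Mazur `p ∤ c₀`, Kobayashi
Thm. 1.2 / 2.2 / 4.1 / 6.2–7.3, Kitajima–Otsuki Thm. 1.3; Poitou–Tate and the plus transport are tree theorems); displayed: `r_an(W) = 0`, the twin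
`V` with the tower clause, the unit certificate «every `L_5⁺(V,η,T)` is a unit», the class-group datum. Instance of
`EtaConjADoorUnitBSD.missingPPartAt_of_heckeEigenHom_of_isUnit` (k8eta-c2 g22). CONDITIONAL; nothing booked. [cite: Kobayashi2003, §4 (p. 8), Thm.
2.2 (p. 5)] [cite: CoatesSujatha2005, §3 (A) and Thm. 3.4] [cite: Zywina2015, Thm. 1.4] -/
theorem missingPPartAt_u5a_29_5_of_heckeEigenHom
    (hGZK : rank_eq_analyticRank_of_analyticRank_le_one) (hmod : hasEntireLFunction_rat)
    (hnf : exists_isNewformOf) (hM : mazur_not_dvd_maninConstant_of_odd)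
    (h12 : Kobayashi2003.thm12_signedSelmerDual_finite_torsion)
    (hKO : KitajimaOtsuki2018.mainThm13_etaSignedSelmerDual_noFiniteSubmodule)
    (h22 : Kobayashi2003.thm22_etaSignedSelmerDual_finite_torsion)
    (h41 : Kobayashi2003.thm41_plusEtaCharIdeal_dvd)
    (h6273 : Kobayashi2003.thm62_63_73_etaColemanPoitouTate) [Fact (5 : ℕ).Prime]
    (W : WeierstrassCurve ℚ) (hW : W = (⟨1, (-1), 1, (-84303680), 297791997822⟩ : WeierstrassCurve ℚ))
    (V : WeierstrassCurve ℚ) [V.IsElliptic] [V.IsGloballyMinimal] (C : VariableChange ℚ)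
    (hC : C • W.quadraticTwist 5 = V)
    (hgood : V.HasGoodReductionAtPrime 5) (hap : V.frobeniusTrace 5 = 0)
    (hns : ¬ ∀ m : ℕ, V.HasSurjectiveModNGaloisRep (5 ^ m : ℕ))
    (hunit : ∀ {N : ℕ} [NeZero N] {f : CuspForm (Gamma0 N) 2}, IsNewformOf V f →
      ∀ (ϖ : ℚ), (if Even (5 / 2) then (ϖ : ℝ) * V.realPeriodRat = plusPeriod f
          else (ϖ : ℝ) * V.imaginaryPeriodRat = minusPeriod f) →
      ∀ (Lη : IwasawaAlgebra 5), IsQuadraticBranchPlusLFunction f 5 ϖ Lη → IsUnit Lη)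
    (hP : haveI : W.IsElliptic := hW ▸ isElliptic_u5a_29
      haveI : NeZero (5 : ℕ) := ⟨by norm_num⟩
      haveI : NumberField (W.divisionField 5) := NumberField.mk
      ∃ P : geomTorsion W ((5 : ℕ) : ℤ), P ≠ 0 ∧
        ∀ K : IntermediateField ℚ (W.divisionField 5),
          K = IntermediateField.fixedField
            ((MulAction.stabilizer (absoluteGaloisGroup ℚ) P).map (absRestrictNormalHom (W.divisionField 5))) →
        ∀ μ : Additive (ClassGroup (𝓞 K)) →+ ZMod 5,
          (∀ (τ : absoluteGaloisGroup ℚ) (σ : K ≃ₐ[ℚ] K) (a : ℕ),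
              (∀ x : K, absRestrictNormalHom (W.divisionField 5) τ (x : W.divisionField 5) =
                ((σ x : K) : W.divisionField 5)) → τ • P = a • P →
              ∀ (I J : (Ideal (𝓞 K))⁰),
                (J : Ideal (𝓞 K)) = (I : Ideal (𝓞 K)).map (AmbiguousClass.intAut σ : 𝓞 K →+* 𝓞 K) →
                μ (Additive.ofMul (ClassGroup.mk0 J)) = a • μ (Additive.ofMul (ClassGroup.mk0 I))) →
          (∀ (τ τ₁ : absoluteGaloisGroup ℚ) (a a₁ b : ℕ) (Q : geomTorsion W ((5 : ℕ) : ℤ)),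
              τ • P = a • P + Q → τ₁ • P = a₁ • P → τ₁ • Q = b • Q → (a₁ : ZMod 5) ≠ (b : ZMod 5) →
              ∀ I : (Ideal (𝓞 K))⁰,
                μ (Additive.ofMul (classGroupNorm K (W.divisionField 5) (ClassGroup.mulEquiv
                  (AmbiguousClass.intAut (absRestrictNormalHom (W.divisionField 5) τ))
                    (classGroupExtend K (W.divisionField 5) (ClassGroup.mk0 I))))) =
                  (Nat.card ((W.divisionField 5) ≃ₐ[K] (W.divisionField 5)) * a) •
                    μ (Additive.ofMul (ClassGroup.mk0 I))) →
          μ = 0) (hr0 : W.analyticRank = 0) :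
    MissingPPartAt W 5 := by
  subst hW
  haveI : (⟨1, (-1), 1, (-84303680), 297791997822⟩ : WeierstrassCurve ℚ).IsElliptic := isElliptic_u5a_29
  haveI : (⟨1, (-1), 1, (-84303680), 297791997822⟩ : WeierstrassCurve ℚ).IsGloballyMinimal := isGloballyMinimal_u5a_29
  haveI : NeZero (5 : ℕ) := ⟨by norm_num⟩
  exact EtaConjADoorUnitBSD.missingPPartAt_of_heckeEigenHom_of_isUnit _ 5 hGZK hmod hnf hM h12 hKO h22 h41 h6273 (le_refl 5) V C
    (by rw [show ((-1 : ℚ) ^ ((5 : ℕ) / 2) * ((5 : ℕ) : ℚ)) = 5 by norm_num]; exact hC) hgood hap hns hP hunit hr0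

end Summit.BirchSwinnertonDyer.BirchSwinnertonDyer.Theorems.EtaConjADoorUnitBSDRecords

end
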